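import Summits.Langlands.Langlands.Theorems.IrreducibilityBySelfDualityReciprocityUpToIrreducibilityRankOneUnramified
import Summits.Langlands.Langlands.Theorems.IrreducibilityBySelfDualityReciprocityUpToIrreducibilityLadicFiniteInertiaConverse
import Summits.Langlands.Langlands.Theorems.IrreducibilityBySelfDualityReciprocityUpToIrreducibilityRankOneMatchingRamified
import Summits.Langlands.Langlands.Theorems.IrreducibilityBySelfDualityReciprocityUpToIrreducibilityRankOneMatchingConverse
import Summits.Langlands.Langlands.Theorems.IrreducibilityBySelfDualityReciprocityUpToIrreducibilityGLOneLocalComponentUnique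
import Literature.NumberTheory.Automorphic.HeckeCharacterLocalComponentSmooth
import Literature.NumberTheory.Automorphic.LParameter
import HarnessLib

/-!
# Line `Sketch` for the crux `ReciprocityUpToIrreducibility` (item stmt-Langlands-14328), continuation c7:
# rank one at the RAMIFIED places — the local–global clause IS the compatibility of `Rec`'s Artin map
# with class field theory on the pair (assembly of wave N7)

Support file (closes nothing; continuation lead c7, prover-line-stmt-Langlands-14328-c7-0).

c4–c6 settled the summit's clause `LocalGlobalCompatibleAt Rec ι π ρ v` for EVERY reciprocity datum at
every place where `π_v` is unramified.  At a place `v ∤ ℓ` where the Hecke character `θ` of a `GL₁`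
datum `π` (acted on by `GL₁(𝔸_K)` through `θ ∘ det` modulo `W'`) may RAMIFY, and for a
`ρ : Γ_K → GL₁(ℚ̄_ℓ)` whose restriction to `W_{K_v}` has finite inertia image
(`WeilGroup.IsContinuousRep`, automatic for open-kernel `ρ`, `isContinuousRep_weilRestrict_toLocal_of_isOpen_ker`),
the five registered stubs of wave N7 give, with no named fact:

  `LocalGlobalCompatibleAt Rec ι π ρ v ↔ ∀ w ∈ W_{K_v}, ι(tr ρ|_{Γ_{K_v}}(w)) = θ_v((Rec.llc v).artin w)`

(`rankOne_localGlobalCompatibleAt_away_iff_artinCompatible`).  `⇐`: the local component is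
`θ_v ∘ det` (`hasLocalComponentAt_ofQuasiChar`, `θ_v` continuous by
`HeckeCharacter.continuous_localComponent`), the Grothendieck–Deligne recipe attaches `(ρ|_W, 0)`
(S-A `isWeilDeligneOfLadic_ofRep_of_isContinuousRep` + `WeilGroup.exists_inertiaCharacter_ne_one`), its
transport along `ι` acts by the scalars `ι(tr ρ(w))` (`transport_ofRep_rankOne`), and the rank-one
matching at an arbitrary place (S-C `hasFrobSemisimpleClass_recGL_one_of_forall`) gives the class
`rec_v(θ_v ∘ det)`.  `⇒`: the recipe returns `(ρ|_W, 0)` itself (S-D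
`eq_ofRep_of_isWeilDeligneOfLadic_of_isContinuousRep`), ANY local component acts through `θ_v ∘ det`
(S-E `localComponent_ρ_apply_eq_of_hasLocalComponentAt`, so `rec_v(π_v) = rec_v(θ_v ∘ det)` by
`IsLocalLanglandsGL.rec_one_mk`), and the converse matching (S-F
`N_eq_zero_and_forall_of_hasFrobSemisimpleClass_recGL_one`) reads the scalars back.

So in rank one the residue B2 of the line's LGC stubs is EXACTLY the statement that `Rec`'s local Artin
map at `v` is compatible with global class field theory on `(θ_v, ρ|_{W_{K_v}})`; for a datum
normalised against THE Artin map (`LocalArtinData.IsCanonical`, Literature 2026-08-16) this is Tate's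
local–global compatibility of the reciprocity maps.  No definitions; std axioms; no named fact assumed.
-/

noncomputable section

set_option linter.dupNamespace false -- project-wide option (lakefile weak.linter.dupNamespace); `Summit.Langlands.Langlands` is the mandated namespace

open scoped MatrixGroups Matrix NumberField Classical
open Filter IsDedekindDomain Field
open Literature.NumberTheory.Automorphic Literature.NumberTheory.GaloisRepresentations
open Literature.NumberTheory.PAdicHodge
open Summit.Langlands

namespace Summit.Langlands.Langlands.Theorems.ReciprocityUpToIrreducibility

/-! ## 1. Local: transports of `(ρ|_{W_F}, 0)` in rank one; finite inertia from an open kernel -/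

section Local

variable {F : Type} [Field F] [ValuativeRel F] [TopologicalSpace F] [IsNonarchimedeanLocalField F]
  {E : Type*} [Field E] [CharZero E] [TopologicalSpace E] {C : Type*} [Field C] [CharZero C]

/-- **Transport of `(ρ|_{W_F}, 0)` in rank one.**  For `ρ : Γ_F → GL₁(E)` with `ρ|_{W_F}` continuous
for the discrete topology and `rC` a transport of `(ρ|_{W_F}, N = 0)` along `ι : E →+* C`: `rC.N = 0`
and every `w ∈ W_F` acts on the line `Fin 1 → C` by the scalar `ι(tr ρ(w))` (a `1 × 1` matrix is its
trace times `1`, `matrix_fin_one_eq_trace_smul_one`). [cite: DeligneAntwerpII1973, §8.4.3]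
[cite: TateCorvallis1979, (4.1.3)] -/
theorem transport_ofRep_rankOne (ρ : FramedRep (absoluteGaloisGroup F) E 1)
    (hc : WeilGroup.IsContinuousRep (ρ.weilRestrict F)) (ι : E →+* C)
    {rC : WeilDeligneRep F C (Fin 1 → C)}
    (htr : (WeilDeligneRep.ofRep (ρ.weilRestrict F) hc).IsTransportAlong ι rC) :
    rC.N = 0 ∧ ∀ w : WeilGroup F, rC.ρ w =
      ι (((ρ.toWeilGroupHom w : GL (Fin 1) E) : Matrix (Fin 1) (Fin 1) E).trace) • LinearMap.id := by
  refine ⟨htr.N_eq_zero (WeilDeligneRep.ofRep_N _ _), fun w => ?_⟩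
  have hmat := htr.1 w
  rw [WeilDeligneRep.ofRep_ρ, toMatrix'_weilRestrict] at hmat
  set M : Matrix (Fin 1) (Fin 1) E := ((ρ.toWeilGroupHom w : GL (Fin 1) E) : Matrix (Fin 1) (Fin 1) E)
    with hM
  have hmatC : LinearMap.toMatrix' (rC.ρ w) = ι M.trace • (1 : Matrix (Fin 1) (Fin 1) C) := by
    rw [hmat, matrix_fin_one_eq_trace_smul_one (M.map ι), Matrix.trace_fin_one, Matrix.trace_fin_one,
      Matrix.map_apply]
  have : rC.ρ w = Matrix.toLin' (ι M.trace • (1 : Matrix (Fin 1) (Fin 1) C)) := by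
    rw [← hmatC, Matrix.toLin'_toMatrix']
  rw [this, map_smul, Matrix.toLin'_one]

/-- Conversely, if a transport `rC` of `(ρ|_{W_F}, 0)` along `ι` acts at `w` by the scalar `c`, then
`c = ι(tr ρ(w))`. [cite: DeligneAntwerpII1973, §8.4.3] -/
theorem eq_of_transport_ofRep_rankOne_of_eq_smul (ρ : FramedRep (absoluteGaloisGroup F) E 1)
    (hc : WeilGroup.IsContinuousRep (ρ.weilRestrict F)) (ι : E →+* C)
    {rC : WeilDeligneRep F C (Fin 1 → C)}
    (htr : (WeilDeligneRep.ofRep (ρ.weilRestrict F) hc).IsTransportAlong ι rC) {w : WeilGroup F}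
    {c : C} (hw : rC.ρ w = c • LinearMap.id) :
    ι (((ρ.toWeilGroupHom w : GL (Fin 1) E) : Matrix (Fin 1) (Fin 1) E).trace) = c := by
  have h := (transport_ofRep_rankOne ρ hc ι htr).2 w
  rw [hw] at h
  have h1 := congrArg (fun f : (Fin 1 → C) →ₗ[C] (Fin 1 → C) => f (fun _ => 1) 0) h
  simpa using h1.symm

/-- `ρ|_{W_F}(w) = 1` as an endomorphism of `Fin n → A` as soon as `ρ.toWeilGroupHom w = 1` (same matrix,
`toMatrix'_weilRestrict`). [folklore] -/
theorem weilRestrict_eq_one_of_toWeilGroupHom_eq_one {A : Type*} [CommRing A] [TopologicalSpace A]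
    {n : ℕ} (ρ : FramedRep (absoluteGaloisGroup F) A n) {w : WeilGroup F}
    (hw : ρ.toWeilGroupHom w = 1) : ρ.weilRestrict F w = 1 :=
  LinearMap.toMatrix'.injective (by rw [toMatrix'_weilRestrict ρ w, hw, Units.val_one, LinearMap.toMatrix'_one])

/-- **Open kernel ⇒ finite inertia image on the Weil group.**  If `ρ : Γ_F → GL_n(A)` has open kernel
then `ρ|_{W_F}` is continuous for the discrete topology: it is trivial on the open subgroup
`I_F ∩ ρ|_{W_F}⁻¹(1)` of inertia (`W_F → Γ_F` is continuous, `WeilGroup.continuous_toAbsGalois_holds`;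
`I_F` is open, `WeilGroup.isOpen_inertia`). [cite: TateCorvallis1979, (1.4.1) and (4.1.2)] -/
theorem isContinuousRep_weilRestrict_of_isOpen_ker {A : Type*} [CommRing A] [TopologicalSpace A]
    {n : ℕ} (ρ : FramedRep (absoluteGaloisGroup F) A n)
    (hker : IsOpen (ρ.toMonoidHom.ker : Set (absoluteGaloisGroup F))) :
    WeilGroup.IsContinuousRep (ρ.weilRestrict F) := by
  refine ⟨WeilGroup.inertia F ⊓ ρ.toMonoidHom.ker.comap (WeilGroup.toAbsGalois F), inf_le_left,
    (WeilGroup.isOpen_inertia F).inter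
      (hker.preimage (WeilGroup.continuous_toAbsGalois_holds F)), fun u hu => ?_⟩
  refine weilRestrict_eq_one_of_toWeilGroupHom_eq_one ρ ?_
  have h2 : ρ (WeilGroup.toAbsGalois F u) = 1 := hu.2
  rw [FramedRep.toWeilGroupHom_apply, h2]

end Local

/-! ## 2. Every rank, `v ∤ ℓ`, finite inertia image: the clause is the `ℓ`-blind matching -/

section FiniteInertia

variable {K : Type} [Field K] [NumberField K] {ℓ : ℕ} [Fact ℓ.Prime] {n : ℕ}
  {hcpt : isCompact_glFiniteIntegralLevel n K}

/-- The restriction to `W_{K_v}` of the localisation at `v` of an open-kernel `ρ : Γ_K → GL_n(A)` has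
finite inertia image (`isContinuousRep_weilRestrict_of_isOpen_ker`; the restriction `Γ_{K_v} → Γ_K`
is continuous). [cite: TateCorvallis1979, (1.4.1)] -/
theorem isContinuousRep_weilRestrict_toLocal_of_isOpen_ker {A : Type*} [CommRing A]
    [TopologicalSpace A] {m : ℕ} (ρ : FramedGaloisRep K A m)
    (hker : IsOpen (ρ.toMonoidHom.ker : Set (absoluteGaloisGroup K))) (v : HeightOneSpectrum (𝓞 K)) :
    WeilGroup.IsContinuousRep ((ρ.toLocal v).weilRestrict (v.adicCompletion K)) := by
  refine isContinuousRep_weilRestrict_of_isOpen_ker (ρ.toLocal v) ?_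
  have h : ((ρ.toLocal v).toMonoidHom.ker : Set (absoluteGaloisGroup (v.adicCompletion K))) =
      absGaloisRestrict K (v.adicCompletion K) ⁻¹' (ρ.toMonoidHom.ker : Set (absoluteGaloisGroup K)) := by
    ext σ
    simp [MonoidHom.mem_ker]
  rw [h]
  exact hker.preimage (absGaloisRestrict K (v.adicCompletion K)).continuous

/-- **Every rank, every `Rec`, `v ∤ ℓ`, finite inertia image: the summit's clause is the `ℓ`-blind
matching** — the finite-inertia ("potentially unramified") generalisation of c4's
`localGlobalCompatibleAt_away_iff_of_isUnramifiedAt`.  For `ρ : Γ_K → GL_n(ℚ̄_ℓ)` whose restriction to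
`W_{K_v}` is trivial on an open subgroup of inertia, `LocalGlobalCompatibleAt Rec ι π ρ v` holds iff
some local component `π_v` of `π` at `v` has `rec_v(π_v)` equal to the Frobenius-semisimple class of a
transport of `(ρ|_{W_{K_v}}, N = 0)` along `ι`: `⇒` by S-D (the recipe returns `(ρ|_W, 0)` itself,
`eq_ofRep_of_isWeilDeligneOfLadic_of_isContinuousRep`), `⇐` by S-A
(`isWeilDeligneOfLadic_ofRep_of_isContinuousRep` with the inertia characters
`WeilGroup.exists_inertiaCharacter_ne_one`).  This covers every pair `(π, ρ)` with `ρ` of Artin type at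
`v`, in particular every twist situation by finite-order characters, whatever the ramification of `π_v`.
[cite: DeligneAntwerpII1973, §8.4.2] [cite: TateCorvallis1979, (4.1.3)–(4.2.1)] -/
theorem localGlobalCompatibleAt_away_iff_of_isContinuousRep
    (Rec : ReciprocityData K) (ι : PadicAlgCl ℓ ≃+* ℂ)
    (π : AutomorphicRepData (AutomorphyDatum.gl n K hcpt)) (ρ : FramedGaloisRep K (PadicAlgCl ℓ) n)
    {v : HeightOneSpectrum (𝓞 K)} (hv : ((ℓ : ℕ) : 𝓞 K) ∉ v.asIdeal)
    (hc : WeilGroup.IsContinuousRep ((ρ.toLocal v).weilRestrict (v.adicCompletion K))) :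
    LocalGlobalCompatibleAt Rec ι π ρ v ↔
      ∃ (πv : SmoothIrrep (GL (Fin n) (v.adicCompletion K)))
        (rℂ : WeilDeligneRep (v.adicCompletion K) ℂ (Fin n → ℂ)),
        π.HasLocalComponentAt v πv.ρ ∧
          (WeilDeligneRep.ofRep ((ρ.toLocal v).weilRestrict (v.adicCompletion K)) hc).IsTransportAlong
            (ι : PadicAlgCl ℓ →+* ℂ) rℂ ∧
          rℂ.HasFrobSemisimpleClass ((Rec.llc v).recGL n (IrrClass.mk πv)) := by
  constructor
  · rintro ⟨πv, r, rℂ, hπv, hlad, -, htr, hcls⟩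
    have hr := eq_ofRep_of_isWeilDeligneOfLadic_of_isContinuousRep (ρ.toLocal v) hc (hlad hv)
    subst hr
    exact ⟨πv, rℂ, hπv, htr, hcls⟩
  · rintro ⟨πv, rℂ, hπv, htr, hcls⟩
    exact ⟨πv, _, rℂ, hπv, fun _ => isWeilDeligneOfLadic_ofRep_of_isContinuousRep (ρ.toLocal v) hc
        fun U hUo => WeilGroup.exists_inertiaCharacter_ne_one (F := v.adicCompletion K) (PadicAlgCl ℓ) U hUo,
      fun hv' => absurd hv' hv, htr, hcls⟩

end FiniteInertia

/-! ## 3. Rank one at an arbitrary place `v ∤ ℓ`: the clause ↔ Artin compatibility on the pair -/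

section Summit

variable {K : Type} [Field K] [NumberField K] {ℓ : ℕ} [Fact ℓ.Prime]
  {hcpt : isCompact_glFiniteIntegralLevel 1 K}

/-- The local component of a Hecke character at `v` as a quasi-character of `K_vˣ` (continuous by
`HeckeCharacter.continuous_localComponent`). [cite: TateThesis1967, §4.3] -/
theorem exists_quasiChar_eq_localComponent (θ : HeckeCharacter K) (v : HeightOneSpectrum (𝓞 K)) :
    ∃ θv : QuasiChar (v.adicCompletion K), ∀ u, θv u = θ.localComponent v u :=
  ⟨ContinuousMonoidHom.mk (θ.localComponent v) (θ.continuous_localComponent v), fun _ => rfl⟩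

/-- **Rank one, every `Rec`, ANY place `v ∤ ℓ` (ramified or not), `⇐`.**  Let `GL₁(𝔸_K)` act on
`π = W/W'` through `θ ∘ det` (mod `W'`) and let `ρ : Γ_K → GL₁(ℚ̄_ℓ)` have finite inertia image on
`W_{K_v}`.  If `ι(tr ρ(w)) = θ_v(artin_v w)` for every `w ∈ W_{K_v}` — compatibility of `Rec`'s Artin
map at `v` with class field theory on the pair `(θ_v, ρ|_{W_{K_v}})` — then
`LocalGlobalCompatibleAt Rec ι π ρ v`: local component `θ_v ∘ det`, `r = (ρ|_{W_{K_v}}, 0)` attached by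
the Grothendieck–Deligne recipe (finite-inertia sector, S-A), its transport along `ι` acts by
`θ_v(artin_v w)` and has `N = 0`, hence class `rec_v[θ_v ∘ det]` (S-C).
[cite: HarrisTaylorAMS2001, Thm. A (i)] [cite: DeligneAntwerpII1973, §8.4.2] [cite: TateCorvallis1979, (4.2.1)] -/
theorem rankOne_localGlobalCompatibleAt_away_of_artinCompatible
    (Rec : ReciprocityData K) (ι : PadicAlgCl ℓ ≃+* ℂ)
    (π : AutomorphicRepData (AutomorphyDatum.gl 1 K hcpt)) (θ : HeckeCharacter K)
    (hact : ∀ (g : (AdelicGroupData.gl 1 K).Adelic), ∀ φ ∈ π.W,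
      rightTranslation (AdelicGroupData.gl 1 K) g φ -
        ((θ (Matrix.GeneralLinearGroup.det g) : ℂˣ) : ℂ) • φ ∈ π.W')
    (ρ : FramedGaloisRep K (PadicAlgCl ℓ) 1) {v : HeightOneSpectrum (𝓞 K)}
    (hv : ((ℓ : ℕ) : 𝓞 K) ∉ v.asIdeal)
    (hc : WeilGroup.IsContinuousRep ((ρ.toLocal v).weilRestrict (v.adicCompletion K)))
    (hcomp : ∀ w : WeilGroup (v.adicCompletion K),
      (ι : PadicAlgCl ℓ →+* ℂ) ((((ρ.toLocal v).toWeilGroupHom w : GL (Fin 1) (PadicAlgCl ℓ)) :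
          Matrix (Fin 1) (Fin 1) (PadicAlgCl ℓ)).trace) =
        ((θ.localComponent v ((Rec.llc v).artin.artin w) : ℂˣ) : ℂ)) :
    LocalGlobalCompatibleAt Rec ι π ρ v := by
  obtain ⟨θv, hθv⟩ := exists_quasiChar_eq_localComponent θ v
  have hloc := hasLocalComponentAt_ofQuasiChar π θ hact v θv hθv
  have hlad := isWeilDeligneOfLadic_ofRep_of_isContinuousRep (ρ.toLocal v) hc fun U hUo =>
    WeilGroup.exists_inertiaCharacter_ne_one (F := v.adicCompletion K) (PadicAlgCl ℓ) U hUo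
  obtain ⟨rℂ, htr⟩ := exists_isTransportAlong (ι : PadicAlgCl ℓ →+* ℂ)
    (WeilDeligneRep.ofRep ((ρ.toLocal v).weilRestrict (v.adicCompletion K)) hc)
  obtain ⟨hN, hρw⟩ := transport_ofRep_rankOne (ρ.toLocal v) hc (ι : PadicAlgCl ℓ →+* ℂ) htr
  have hρw' : ∀ w : WeilGroup (v.adicCompletion K),
      rℂ.ρ w = ((θv ((Rec.llc v).artin.artin w) : ℂˣ) : ℂ) • LinearMap.id := fun w => by
    rw [hρw w, hcomp w, hθv]
  exact ⟨SmoothIrrep.ofQuasiChar θv, _, rℂ, hloc, fun _ => hlad, fun hv' => absurd hv' hv, htr,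
    hasFrobSemisimpleClass_recGL_one_of_forall (Rec.llc v) rℂ hN hρw'⟩

/-- **Rank one, every `Rec`, ANY place `v ∤ ℓ`, `⇒`.**  Conversely `LocalGlobalCompatibleAt Rec ι π ρ v`
forces `ι(tr ρ(w)) = θ_v(artin_v w)` for every `w ∈ W_{K_v}`: the attached `r` IS `(ρ|_{W_{K_v}}, 0)`
on the finite-inertia sector (S-D), any local component acts through `θ_v ∘ det` (S-E) so its class
under `rec_v` is that of `θ_v ∘ det` (`IsLocalLanglandsGL.rec_one_mk`), and a Weil–Deligne
representation on the line in that class acts by `θ_v(artin_v w)` (S-F).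
[cite: HarrisTaylorAMS2001, Thm. A (i)] [cite: DeligneAntwerpII1973, §8.4.2] [cite: FlathCorvallis1979, Thm. 3] -/
theorem artinCompatible_of_rankOne_localGlobalCompatibleAt_away
    (Rec : ReciprocityData K) (ι : PadicAlgCl ℓ ≃+* ℂ)
    (π : AutomorphicRepData (AutomorphyDatum.gl 1 K hcpt)) (θ : HeckeCharacter K)
    (hact : ∀ (g : (AdelicGroupData.gl 1 K).Adelic), ∀ φ ∈ π.W,
      rightTranslation (AdelicGroupData.gl 1 K) g φ -
        ((θ (Matrix.GeneralLinearGroup.det g) : ℂˣ) : ℂ) • φ ∈ π.W')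
    (ρ : FramedGaloisRep K (PadicAlgCl ℓ) 1) {v : HeightOneSpectrum (𝓞 K)}
    (hv : ((ℓ : ℕ) : 𝓞 K) ∉ v.asIdeal)
    (hc : WeilGroup.IsContinuousRep ((ρ.toLocal v).weilRestrict (v.adicCompletion K)))
    (h : LocalGlobalCompatibleAt Rec ι π ρ v) :
    ∀ w : WeilGroup (v.adicCompletion K),
      (ι : PadicAlgCl ℓ →+* ℂ) ((((ρ.toLocal v).toWeilGroupHom w : GL (Fin 1) (PadicAlgCl ℓ)) :
          Matrix (Fin 1) (Fin 1) (PadicAlgCl ℓ)).trace) =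
        ((θ.localComponent v ((Rec.llc v).artin.artin w) : ℂˣ) : ℂ) := by
  obtain ⟨πv, r, rℂ, hloc, hlad, -, htr, hcls⟩ := h
  have hr := eq_ofRep_of_isWeilDeligneOfLadic_of_isContinuousRep (ρ.toLocal v) hc (hlad hv)
  subst hr
  obtain ⟨θv, hθv⟩ := exists_quasiChar_eq_localComponent θ v
  -- any local component acts through `θ_v ∘ det`, so `rec_v(π_v) = rec_v(θ_v ∘ det)`
  have hπv : ∀ (g : GL (Fin 1) (v.adicCompletion K)) (x : πv.V),
      πv.ρ g x = ((θv (Matrix.GeneralLinearGroup.det g) : ℂˣ) : ℂ) • x := fun g x => by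
    rw [localComponent_ρ_apply_eq_of_hasLocalComponentAt π θ hact v πv hloc g x, hθv]
  have hcls' : rℂ.HasFrobSemisimpleClass
      ((Rec.llc v).recGL 1 (IrrClass.mk (SmoothIrrep.ofQuasiChar θv))) := by
    rw [(Rec.llc v).isLocalLanglands.rec_one_mk (SmoothIrrep.ofQuasiChar_ρ_apply θv),
      ← (Rec.llc v).isLocalLanglands.rec_one_mk hπv]
    exact hcls
  obtain ⟨-, hρw⟩ := N_eq_zero_and_forall_of_hasFrobSemisimpleClass_recGL_one (Rec.llc v) hcls'
  intro w
  rw [eq_of_transport_ofRep_rankOne_of_eq_smul (ρ.toLocal v) hc (ι : PadicAlgCl ℓ →+* ℂ) htr (hρw w),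
    hθv]

/-- **Rank one, every `Rec`, ANY place `v ∤ ℓ`: the summit's local–global clause IS the compatibility
of `Rec`'s Artin map at `v` with class field theory on the pair.**  For `π` acted on through
`θ ∘ det` and `ρ : Γ_K → GL₁(ℚ̄_ℓ)` with finite inertia image on `W_{K_v}`:
`LocalGlobalCompatibleAt Rec ι π ρ v ↔ ∀ w ∈ W_{K_v}, ι(tr ρ|_{Γ_{K_v}}(w)) = θ_v((Rec.llc v).artin w)`.
At a place where `θ` is unramified this is c4's Satake-clause equivalence read on Frobenii; at a
RAMIFIED place it is the exact residue B2 of the line's local–global stubs in rank one: for a datum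
normalised against THE Artin map, Tate's local–global compatibility of the reciprocity maps.
[cite: HarrisTaylorAMS2001, Thm. A (i)] [cite: TateCorvallis1979, (4.2.1)]
[cite: CasselsFrohlichANT1967, Ch. VII §5.1 Main Theorem] -/
theorem rankOne_localGlobalCompatibleAt_away_iff_artinCompatible
    (Rec : ReciprocityData K) (ι : PadicAlgCl ℓ ≃+* ℂ)
    (π : AutomorphicRepData (AutomorphyDatum.gl 1 K hcpt)) (θ : HeckeCharacter K)
    (hact : ∀ (g : (AdelicGroupData.gl 1 K).Adelic), ∀ φ ∈ π.W,
      rightTranslation (AdelicGroupData.gl 1 K) g φ -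
        ((θ (Matrix.GeneralLinearGroup.det g) : ℂˣ) : ℂ) • φ ∈ π.W')
    (ρ : FramedGaloisRep K (PadicAlgCl ℓ) 1) {v : HeightOneSpectrum (𝓞 K)}
    (hv : ((ℓ : ℕ) : 𝓞 K) ∉ v.asIdeal)
    (hc : WeilGroup.IsContinuousRep ((ρ.toLocal v).weilRestrict (v.adicCompletion K))) :
    LocalGlobalCompatibleAt Rec ι π ρ v ↔
      ∀ w : WeilGroup (v.adicCompletion K),
        (ι : PadicAlgCl ℓ →+* ℂ) ((((ρ.toLocal v).toWeilGroupHom w : GL (Fin 1) (PadicAlgCl ℓ)) :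
            Matrix (Fin 1) (Fin 1) (PadicAlgCl ℓ)).trace) =
          ((θ.localComponent v ((Rec.llc v).artin.artin w) : ℂˣ) : ℂ) :=
  ⟨artinCompatible_of_rankOne_localGlobalCompatibleAt_away Rec ι π θ hact ρ hv hc,
    rankOne_localGlobalCompatibleAt_away_of_artinCompatible Rec ι π θ hact ρ hv hc⟩

/-- **The open-kernel form** (finite-order Hecke characters, Artin characters): for `ρ` with open
kernel the finite-inertia hypothesis is automatic, so at every `v ∤ ℓ`
`LocalGlobalCompatibleAt Rec ι π ρ v ↔ ∀ w, ι(tr ρ(w)) = θ_v(artin_v w)`.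
[cite: HarrisTaylorAMS2001, Thm. A (i)] [cite: TateCorvallis1979, (4.2.1)] -/
theorem rankOne_localGlobalCompatibleAt_away_iff_artinCompatible_of_isOpen_ker
    (Rec : ReciprocityData K) (ι : PadicAlgCl ℓ ≃+* ℂ)
    (π : AutomorphicRepData (AutomorphyDatum.gl 1 K hcpt)) (θ : HeckeCharacter K)
    (hact : ∀ (g : (AdelicGroupData.gl 1 K).Adelic), ∀ φ ∈ π.W,
      rightTranslation (AdelicGroupData.gl 1 K) g φ -
        ((θ (Matrix.GeneralLinearGroup.det g) : ℂˣ) : ℂ) • φ ∈ π.W')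
    (ρ : FramedGaloisRep K (PadicAlgCl ℓ) 1)
    (hker : IsOpen (ρ.toMonoidHom.ker : Set (absoluteGaloisGroup K))) {v : HeightOneSpectrum (𝓞 K)}
    (hv : ((ℓ : ℕ) : 𝓞 K) ∉ v.asIdeal) :
    LocalGlobalCompatibleAt Rec ι π ρ v ↔
      ∀ w : WeilGroup (v.adicCompletion K),
        (ι : PadicAlgCl ℓ →+* ℂ) ((((ρ.toLocal v).toWeilGroupHom w : GL (Fin 1) (PadicAlgCl ℓ)) :
            Matrix (Fin 1) (Fin 1) (PadicAlgCl ℓ)).trace) =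
          ((θ.localComponent v ((Rec.llc v).artin.artin w) : ℂˣ) : ℂ) :=
  rankOne_localGlobalCompatibleAt_away_iff_artinCompatible Rec ι π θ hact ρ hv
    (isContinuousRep_weilRestrict_toLocal_of_isOpen_ker ρ hker v)

/-- **Registered stub `stub_rankOne_localGlobal_away_iff_artinCompatible` of line `Sketch` (crux
stmt-Langlands-14328, c7 wave N7 assembly), closed form of
`rankOne_localGlobalCompatibleAt_away_iff_artinCompatible`**: for every `Rec`, every place `v ∤ ℓ`, a `GL₁`
datum acted on through `θ ∘ det` and `ρ : Γ_K → GL₁(ℚ̄_ℓ)` with finite inertia image on `W_{K_v}`, the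
summit's local–global clause at `v` holds iff `ι(tr ρ|_{Γ_{K_v}}(w)) = θ_v((Rec.llc v).artin w)` for all
`w ∈ W_{K_v}`. [cite: HarrisTaylorAMS2001, Thm. A (i)] [cite: TateCorvallis1979, (4.2.1)] -/
theorem stub_rankOne_localGlobal_away_iff_artinCompatible :
    ∀ (K : Type) [Field K] [NumberField K] (ℓ : ℕ) [Fact ℓ.Prime]
      (hcpt : isCompact_glFiniteIntegralLevel 1 K) (Rec : ReciprocityData K) (ι : PadicAlgCl ℓ ≃+* ℂ)
      (π : AutomorphicRepData (AutomorphyDatum.gl 1 K hcpt)) (θ : HeckeCharacter K),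
      (∀ (g : (AdelicGroupData.gl 1 K).Adelic), ∀ φ ∈ π.W,
        rightTranslation (AdelicGroupData.gl 1 K) g φ -
          ((θ (Matrix.GeneralLinearGroup.det g) : ℂˣ) : ℂ) • φ ∈ π.W') →
      ∀ (ρ : FramedGaloisRep K (PadicAlgCl ℓ) 1) (v : HeightOneSpectrum (𝓞 K)),
        ((ℓ : ℕ) : 𝓞 K) ∉ v.asIdeal →
        WeilGroup.IsContinuousRep ((ρ.toLocal v).weilRestrict (v.adicCompletion K)) →
        (LocalGlobalCompatibleAt Rec ι π ρ v ↔
          ∀ w : WeilGroup (v.adicCompletion K),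
            (ι : PadicAlgCl ℓ →+* ℂ) ((((ρ.toLocal v).toWeilGroupHom w : GL (Fin 1) (PadicAlgCl ℓ)) :
                Matrix (Fin 1) (Fin 1) (PadicAlgCl ℓ)).trace) =
              ((θ.localComponent v ((Rec.llc v).artin.artin w) : ℂˣ) : ℂ)) :=
  fun _ _ _ _ _ _ Rec ι π θ hact ρ _ hv hc =>
    rankOne_localGlobalCompatibleAt_away_iff_artinCompatible Rec ι π θ hact ρ hv hc

end Summit

end Summit.Langlands.Langlands.Theorems.ReciprocityUpToIrreducibility

end
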